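import Summits.AtomisticToContinuum.HydrodynamicLimit.Theses.InformationPercolationEngine
import Summits.AtomisticToContinuum.HydrodynamicLimit.Theorems.KickIsotropyInfo.Negative.KickIsotropyInfoFalseOfShieldingBiasPersists
import Summits.AtomisticToContinuum.HydrodynamicLimit.Theorems.InformationPercolationEngineKickFairRelEquilibriumTransfer

/-!
# Disproof of `KickFairRelEquilibrium` (crux stmt-AtomisticToContinuum-14914, route
InformationPercolationEngine) — standing adversary file (cdisprove), findings:

* **F0 (typing; no junk escape, no cheap kill).** The decl elaborates; `kickFairRelEquilibrium_iff`
  (§1) repackages its `let`-chain into `kickSumRel` / `KickBoundRel` by `Iff.rfl`, so everything below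
  manipulates the crux itself. Flows exist at every `0 < σ < 1/2` for all `N` (`nonempty_flow`,
  Alexander's theorem, PROVED in the tree) and on their Liouville-conull good set they ARE the
  hard-sphere dynamics (`IsHardSphereTrajectory`: free flight + elastic binary collisions; forward
  uniqueness proved), `localGibbsLaw = liouville.withDensity(canonicalDensity) ≪ liouville` is a
  probability measure for `σ ≤ 1/2` — so the `∀ Φ` is neither vacuous nor junk-inhabited, the `else`
  branches of `P`/`X` and the unspecified flow off `good` are invisible to `∫⁻ … dLG`, and
  `κ = condExp (comap P) G (g ∘ X)` is Mathlib's genuine conditional expectation as soon as `P` is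
  Borel (good-set cut + `HardSphereFlowMeasurable`). Conventions read back: `ε = σ(N+1)^{-1/3}`;
  `nthCollisionTimeOf i n = (nextTimeAfter S)^[n+1] 0` (`n = 0` the first collision AFTER `0`) matches
  `Finset.range (cnt z i)`, `cnt = ncard (collisionTimesOf ∩ Ioc 0 τ)`; `v⁻ = ` velocity of `i` in
  the first snapshot and `v*⁻ = ` the partner's in the second (on `good`, by `flightStart` + right
  continuity; in tree as `Theorems.stub_preVel_eq_flightStart_vel`, OneFlightGossipEngine line), so a
  test `g(v, w)` not reading `ω` has `g ∘ X = κ` a.s. and `S = 0` — consistent.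
  RECORDED FOR PROVERS (typing subtlety, not a kill): past the last collision `nextTimeAfter` returns
  `sInf ∅ = 0` and the enumeration RESTARTS from `0` (period `k + 1` when `i` has `k < ∞` collisions in
  `(0, ∞)`; §5 `nthTimeAfter_singleton`), so recycled indices `n ≥ cnt` carry pasts `P z i n` equal to
  genuine earlier ones and the summation cut `1{n < cnt z i}` is `σ(P_{i,n})`-measurable only modulo
  the event "finitely many collisions of `i` in `(0,∞)`", which a proof must show `G`-null (Poincaré
  recurrence for the measure-preserving flow + a.e. recurrence of collisions) before using
  `E_G[1{n<cnt} h(P)(g − κ)] = 0`; EVERY consumer of exact centring (memo F1, card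
  `only-strangers-matter`, the line's Stage 2) inherits this obligation.
* **F1 (no unconditional kill is reachable; why).** `¬ KickFairRelEquilibrium` needs a LOWER bound on
  `E_{LG}|S_h|`, i.e. LLN-level control from below of a positive fraction of the `≍ N^{4/3}` collisions
  of the deterministic flow (`S` has `≍ N^{4/3}` terms of size `≍ N^{-4/3}`); the tree bounds no
  collision statistic of the `N`-body flow from below (no collision-rate identity, no Palm/Campbell
  formula for marked collision sums with past marks — `HardSphereCollisionCampbell` is the fact, not a
  theorem —, no contact-value theorem), and `κ` — a conditional expectation given the comap σ-algebra
  of a `6(N+1)`-dimensional past map — is not computable on any explicit event. Same standing as the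
  13478 hold. Hence the kills below are CONDITIONAL on one dynamical inequality each, isolated as a
  `Prop` with its mechanism, exactly as `ShieldingBiasPersists`.
* **F2 (the fixed-`r` defect of the decl AS TYPED; `H = SubcellClusteringBiasPersists`, §3; LANDING
  as `Theorems/KickFairRelEquilibrium/Negative/KickFairRelEquilibriumFalseOfSubcellClusteringBias.lean`,
  proposals p99033 → superseded by the zonal/existential-weight version filed 2026-08-16).** Pure
  activity tilt (`a₀` non-constant, `θ₀ ≡ 1`, `u₀ ≡ 0`) gives EXACTLY `dLG/dG = Z⁻¹ ∏_k a₀(x_k(0))`, so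
  the defect of the compensated sum is `E_{LG}[h(P)(g − κ)] = Z⁻¹ E_G[h(P) · Cov_G(∏_k a₀(x_k(0)), g(X) | σ(P))]`
  — the `G`-conditional covariance, GIVEN THE TYPED PAST, between the sub-cell activity tilt and the
  kick. Heuristic evaluation (first flights exactly; later flights under the positive-time
  local-equilibrium fine structure every proof of the crux presupposes). First order in the sub-cell
  displacement: zero (translation covariance of the `ε`-scale kick geometry inside an `r`-cell; error
  `O(ε|∇log a₀| + ℓ/r)`, = ideator 2's "first flights are static"). Second order: the collision point
  (density `∝ a₀²` in the cell under `LG | P` — the resolved cluster of the two partners floats with the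
  product tilt —, Lebesgue under the homogeneous `G | P`) is CO-LOCATED with the UNRESOLVED third
  bodies (sub-cell-random spheres, density `∝ a₀`): their conditional intensity near the contact
  configuration is enhanced by `1 + c₂`, `c₂ ≥ (r²/12)(2α)·α = r²|α|²/6 > 0`, `α = ∇ log a₀` (cube cell;
  sign by `∫ρ³∫ρ ≥ (∫ρ²)²`). Unresolved third bodies enter the conditional kick LAW at first order in `φ`
  through the `ω`-dependent overlap of the two radius-`ε` approach tubes meeting at the contact
  configuration (grazing impacts leave a smaller union of excluded space-time volume: a zonal distortion
  of relative size `≍ φ`) — call `B_U(P)` this UNRESOLVED part of the conditional bias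
  `B(P) = κ(P) − ḡ₀(v,w)` (`ḡ₀` = flux mean); the RESOLVED part `B_R` (caps cut by previous partners
  pinned by the two snapshots: the 13478 shielding) is the same under both laws and CANCELS in the
  defect. Net: `E_{LG}[g | P] − κ(P) = c₂ · B_U(P) · (1 + o(1)) + O(ε|α| + ℓ/r + Kn)`, `N`-INDEPENDENT at
  fixed `r` — up to one more term of the SAME order `c₂φ`: where the typed past leaves the ring /
  two-body ambiguity open (did the previous partner of one sphere also start the other's flight?),
  the enhanced anonymous intensity reweights the two explanations by `(1 + c₂)` and suppresses the
  ring term: `Δ = c₂ (B_U − B_ring)`. QUANTIFIED by cartoon v2 (kit j017516, integrating the model by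
  parts over the exponential flight laws: `E_Palm[Δ]/c₂ = C_i + C_q`, `C_i = n Cov_k(g, E_a|SC_i(a) ∩
  B₁(−ω)|)`, `C_q = n Cov_k(g, E_b|B₁(0) ∩ SC_q(b, ω)|)` — one partner's approach tube against the
  other's final excluded ball): for `g = cos²`, `φ = 0.05`: `C_i + C_q = −0.00285 ± 0.00005` (negative
  for 97% of pasts; `E B_ring = −0.0014`, `E B_cap = +0.0057`) against `E B_U = −0.00428 ± 0.00009` when
  the ring is resolved by the past: the `h ≡ 1` coefficient is bracketed in `[−0.0043, −0.0029]`
  (zonalTest: `[−0.00174, −0.00121]`; `φ = 0.15`, cos²: `[−0.0085, −0.0068]`) — same sign, same order,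
  NO cancellation. WEIGHTS (refines memo `Analysis-r1-k1.md` §F3): Palm isotropy of a homogeneous Gibbs state
  (`ω` flux-uniform given the velocities of ALL spheres at a collision) forces `E_Palm[B_U + B_R | v,w] = 0`,
  not `E_Palm[B_U] = 0`: the memo's `h ≡ 1` with zonal `g` sees `c₂ E_Palm[B_U] = −c₂ E_Palm[B_R]`,
  nonzero iff the resolved shields leave a net zonal imprint (plausible, UNCERTIFIED); the
  past-measurable sign of the first-order tube-overlap functional `b_U(v, w, t − s_i, t − s_q; velocity
  sample)` sees `c₂ E|E[B_U | v, w, flights]| > 0` as soon as `B_U ≢ 0`; the 13478 shield weight sees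
  `c₂ (T − T_R)`, of unknown size (it was built to detect `B_R`). Hence `H` is stated with the zonal
  test EXPLICIT (`zonalTest`, §2) and the admissible weight EXISTENTIAL. CARTOON (dynamics-free, first
  order in `φ`, kit j017199, `cartoon/tube_overlap_bias.py`: Palm-sampled `(v, w)`, flux-sampled `ω`,
  backward flights `Exp(ν(|v|))`, Poisson anonymous bodies with Maxwellian velocities, forbidden iff
  inside the comoving spherocylinders of the two approach paths; `B_U`-shift `= n·Cov_k(g, E_u|SC_i ∩
  SC_q(ω)|)`): for `g = cos²∠(ω, w − v)` the Palm MEAN shift is `E_Palm[B_U] = −0.00425 ± 0.00008` at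
  `φ = 0.05` (NEGATIVE for 99% of sampled pasts: grazing impacts favoured, sign-definite) and
  `−0.0080 ± 0.0002` at `φ = 0.15`; for the Lean `zonalTest` (`= cos² · |b|²/(2(1+|b|²))`):
  `−0.00174 ± 0.00003` resp. `−0.00334 ± 0.00008`. So (within the cartoon) the memo's `h ≡ 1` ALREADY
  WORKS — isotropy is restored by the start-cap (previous-partner) terms `B_R`, which the clustering
  does not enhance — and `E_{LG} S_1 → ⟨c₂⟩ · E_Palm[B_U] · εΓτ`: relative defect
  `≈ 7·10⁻⁴ · (r|∇log a₀|)²` at `φ = 0.05` (`7·10⁻⁶` at `r|α| = 0.1`, `7·10⁻⁴` at `r|α| = 1`; the memo's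
  `m̄ s₁ ≈ 0.02…0.3` overestimates `|E_Palm B_U| ≈ 0.004` by one to two orders) — the clause
  `∀ r ∀ δ ∃ N₀` fails BY A HAIR at every `σ` (no `σ₀` escape: `∝ φ σ³ ≠ 0`); CLASS misstated — the
  defect is `∝ r²`, the repaired decl (`∀ δ ∃ r₀ ∀ r < r₀ ∃ N₀`, R1; or cells `r_N → 0` with
  `ε ≪ r_N ≪ N^{-1/6}`, R2) is missed by the witness. The same `c₂ B_U` structure also sinks, at fixed
  `r`, ideator 2's `TaggedPairOrthogonality` (`E_{LG} Z₀Z₁ → (σ c₂ s_U)² ≠ 0`) and `AtomwiseKickFairness`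
  ("uniformly over sources": a source with an `O(1)` sub-cell density wave has `c₂ = O(1)`).
* **F3 (line `Sketch`, the lead's `disprover-wanted`; `H' = SubcellModeTailLowerBound`, §4).** The
  registered stub `stub_eqKickTail` asks `∫⁻ (|S_h| − δ)₊ dG_{θ₁} ≤ e^{−K(N+1)}` for EVERY rate `K`.
  Under the INVARIANT law a sub-cell density (heat/sound) mode of relative amplitude `a` at wavelength
  `N^{-1/6} ≪ λ ≪ r` costs `G(E_a) = e^{−cNa²(1+o(1))}` (i.i.d. positions at a fixed time), is
  invisible to the typed past (cells `≫ λ`; velocities ⊥ positions at a fixed time), lives `≥ τ`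
  (`λ² ≫ ℓv̄τ`), and on `E_a` the clustering factor of collision points with unresolved third bodies is
  `c₂(a) = ⟨ρ³⟩/(⟨ρ²⟩⟨ρ⟩) − 1 = a² + O(a⁴)`, so `E_G[g | P, E_a] − κ(P) ≈ a² B_U(P)` and, with the
  weight `h = sign E[B_U | v, w, flights]` (or `h ≡ 1` if `E_Palm[B_U] ≠ 0`) and the zonal test,
  `S_h ≈ a² s_U εΓτ > 2δ` once `a² ≳ 2δ/(s_U εΓτ)`: `∫⁻(|S_h| − δ)₊ dG ≥ δ G(E_a) ≥ δ e^{−C δ N}` — speed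
  EXACTLY `N` with a constant `∝ δ`, never super-exponential: `stub_eqKickTail` fails for `K > Cδ` at
  every fixed `r` (and under R1); consistent only in the R2 window.
  `stubEqKickTail_false_of_subcellModeTailLowerBound` (§4) is the sorry-free reduction against a VERBATIM
  restatement `StubEqKickTail` of the stub (the `Lines/Sketch` module is not built on the farm, so the
  identity with `Sketch.stub_eqKickTail` is by text — but BY KERNEL with the hypothesis of the landed Stage-1 reduction `Theorems.KickFairRelEquilibrium_of_eqKickTail`, §4 `example`; `stubEqKickTail_iff` is `Iff.rfl`), with
  the zonal test explicit and the admissible weight existential as in `H`. ¬stub ⇏ ¬decl (Stage 1 is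
  one-way).
* **F4 (hypothesis census — what is load-bearing, none landable as `_false_without_` for want of F1).**
  `|h| ≤ 1`: without it `S` scales (false as soon as `S ≢ 0`). `Continuous g`/bounded: measurable
  bounded `g` would do; unbounded `g` scales. Good-set cut: without it `P` may be non-measurable for an
  admissible flow (junk off `good`), `κ = 0` and the ABSOLUTE form returns (false: 13478 shielding, or
  `g ≡ 1`). `σ < σ₀`: immaterial to F2/F3 (defects `∝ σ³`, present at every `σ`). `r` FIXED before
  `N → ∞`: THE load-bearing misstatement (F2). Equilibrium half (a) = uniform-in-`N` conditional mixing
  of the flow against pasts reading the GLOBAL velocity snapshot (memo §A): no finite witness.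
* **F5 (dead ends, so nobody repeats them).** Junk flows (none: `free`/`binary`/`mem` force the true
  dynamics; identity/pass-through flows violate them off null sets); `κ`-junk via non-measurable `P`
  (closed by the cut); pinning of `ω` by the past (subcritical: `≈ N/2` resolved kicks × 2 affine
  equations `< 3N` unknowns; else the decl would be TRIVIALLY true); temperature/drift-only profiles
  (`LG` = another homogeneous Gibbs state, `G(·|P)` parameter-free: `Δ ≡ 0`); first-order sub-cell
  tilt (`O(ε∇ + ℓ/r) → 0`); MD of the relative statistic (impossible: `κ` is not computable; raw
  `E_{LG}[hg]` vs `E_G[hg]` is confounded at `O(Kn) ≈ 0.1–0.3` for accessible `N`).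
-/

open MeasureTheory Metric Real Set Filter
open scoped InnerProductSpace ENNReal BigOperators Classical

namespace Summit.AtomisticToContinuum.HydrodynamicLimit.Cruxes.KickFairRelEquilibrium.Disproof

noncomputable section

open Literature.MathematicalPhysics.KineticTheory (T3 V3 hsDiameter localGibbsLaw)
open Literature.Analysis.FluidPDE (HardSphereFlow Config collisionTimesOf flightStart Geometry
  nextTimeAfter nthTimeAfter)
open Summit.AtomisticToContinuum.HydrodynamicLimit.Theses.InformationPercolationEngine
  (KickFairRelEquilibrium)
open Summit.AtomisticToContinuum.HydrodynamicLimit.Theorems.KickIsotropyInfoNegative (Past Flow)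

/-! ## §1 The crux, repackaged (definitionally) — identical to the Negative file -/

/-- The typed coarse past of `KickFairRelEquilibrium`: the 13478 past with the three times. -/
abbrev PastRel (N : ℕ) : Type := Past N × (ℝ × ℝ × ℝ)

/-- The compensated (equilibrium-centred) kick sum `S_h` of the crux — its `let`-chain verbatim. -/
def kickSumRel (σ : ℝ) (N : ℕ) (Φ : Flow σ N) (τ r : ℝ) (g : V3 × V3 × V3 → ℝ)
    (h : Fin (N + 1) → ℕ → PastRel N → ℝ) (z : Config (N + 1) (Fin 3) T3) : ℝ :=
  let ε := hsDiameter σ N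
  let G : Geometry (Fin 3) T3 := Literature.Analysis.FluidPDE.Torus.geometry (Fin 3)
  let q : T3 → (Fin 3 → ℤ) := Literature.Analysis.FluidPDE.Torus.coarseCell r
  let γ : Config (N + 1) (Fin 3) T3 → ℝ → Config (N + 1) (Fin 3) T3 := fun z s => Φ.flow s z
  let cnt : Config (N + 1) (Fin 3) T3 → Fin (N + 1) → ℕ := fun z i =>
    Set.ncard (collisionTimesOf G ε (γ z) i ∩ Set.Ioc 0 τ)
  let P : Config (N + 1) (Fin 3) T3 → Fin (N + 1) → ℕ →
      (((Fin (N + 1) → (Fin 3 → ℤ) × V3) × (Fin (N + 1) → (Fin 3 → ℤ) × V3)) × Fin (N + 1)) ×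
        (ℝ × ℝ × ℝ) := fun z i n =>
    if z ∈ Φ.good then
      ((Φ.coarsePastOf q i n z, Φ.nthPartnerOf i n z),
        (flightStart G ε (γ z) 0 i (Φ.nthCollisionTimeOf i n z),
          flightStart G ε (γ z) 0 (Φ.nthPartnerOf i n z) (Φ.nthCollisionTimeOf i n z),
          Φ.nthCollisionTimeOf i n z))
    else (((fun _ => (0, 0), fun _ => (0, 0)), 0), (0, 0, 0))
  let X : Fin (N + 1) → ℕ → Config (N + 1) (Fin 3) T3 → V3 × V3 × V3 := fun i n z =>
    if z ∈ Φ.good then ((Φ.nthRecordOf i n z).impactVec, (Φ.nthRecordOf i n z).preVel) else 0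
  let κ : Fin (N + 1) → ℕ → Config (N + 1) (Fin 3) T3 → ℝ := fun i n =>
    MeasureTheory.condExp (MeasurableSpace.comap (fun z => P z i n) inferInstance)
      (localGibbsLaw σ (fun _ => 1) (fun _ => 0) (fun _ => 1) N Φ) (fun z => g (X i n z))
  ε / (N + 1 : ℝ) * ∑ i : Fin (N + 1), ∑ n ∈ Finset.range (cnt z i),
    h i n (P z i n) * (g (X i n z) - κ i n z)

/-- The conclusion of the crux for given data: `‖S_h‖_{L¹(local Gibbs law)} ≤ δ`. -/
def KickBoundRel (σ : ℝ) (a₀ θ₀ : T3 → ℝ) (u₀ : T3 → V3) (N : ℕ) (Φ : Flow σ N) (τ r : ℝ)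
    (g : V3 × V3 × V3 → ℝ) (h : Fin (N + 1) → ℕ → PastRel N → ℝ) (δ : ℝ) : Prop :=
  ∫⁻ z, ENNReal.ofReal |kickSumRel σ N Φ τ r g h z| ∂(localGibbsLaw σ a₀ u₀ θ₀ N Φ) ≤
    ENNReal.ofReal δ

/-- **Faithful restatement** of the crux (definitional unfolding). -/
theorem kickFairRelEquilibrium_iff :
    KickFairRelEquilibrium ↔
      ∀ (a₀ θ₀ : T3 → ℝ) (u₀ : T3 → V3), Continuous a₀ → Continuous θ₀ → Continuous u₀ →
        (∀ x, 0 < a₀ x) → (∀ x, 0 < θ₀ x) → ∃ σ₀ : ℝ, 0 < σ₀ ∧ ∀ σ : ℝ, 0 < σ → σ < σ₀ →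
        ∀ Φ : (N : ℕ) → Flow σ N, ∀ τ : ℝ, 0 < τ → ∀ r : ℝ, 0 < r →
        ∀ g : V3 × V3 × V3 → ℝ, Continuous g → (∃ C : ℝ, ∀ p, |g p| ≤ C) →
        ∀ δ : ℝ, 0 < δ → ∃ N₀ : ℕ, ∀ N : ℕ, N₀ ≤ N →
        ∀ h : Fin (N + 1) → ℕ → PastRel N → ℝ, (∀ i n, Measurable (h i n)) →
        (∀ i n p, |h i n p| ≤ 1) → KickBoundRel σ a₀ θ₀ u₀ N (Φ N) τ r g h δ :=
  Iff.rfl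

/-! ## §2 The witness: tilted activity and the zonal kick test -/

/-- **The tilted activity** `a₀(x) = 2 + cos(2π x₀)`: a pure density modulation along the first axis
of `𝕋³` (`|∇ log a₀| ≤ 2π`, values in `[1, 3]`). -/
def tiltedActivity (x : T3) : ℝ := 2 + (fourier 1 (x 0) : ℂ).re

/-- The tilted activity is continuous. [folklore] -/
theorem continuous_tiltedActivity : Continuous tiltedActivity :=
  continuous_const.add (Complex.continuous_re.comp ((fourier 1).continuous.comp (continuous_apply 0)))

/-- The tilted activity is positive (indeed `≥ 1`). [folklore] -/
theorem tiltedActivity_pos (x : T3) : 0 < tiltedActivity x := by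
  have h1 : ‖(fourier 1 (x 0) : ℂ)‖ = 1 := by
    rw [fourier_apply, Circle.norm_coe]
  have h2 : |(fourier 1 (x 0) : ℂ).re| ≤ 1 := (Complex.abs_re_le_norm _).trans h1.le
  have h3 : -1 ≤ (fourier 1 (x 0) : ℂ).re := (abs_le.1 h2).1
  unfold tiltedActivity
  linarith

/-- **The zonal kick test** `g(ω, v, w) = ⟪ω, w − v⟫² / ((1 + ‖ω‖²)(1 + ‖w − v‖²))`: on the unit
sphere a positive multiple (depending on `(v, w)` only) of `cos²` of the angle between the impact vector
and the relative velocity — even, zonal about the collision axis: the probe of "grazing versus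
head-on" that a tube-overlap (shadow) distortion of the kick law moves at first order. -/
def zonalTest (p : V3 × V3 × V3) : ℝ :=
  ⟪p.1, p.2.2 - p.2.1⟫_ℝ ^ 2 / ((1 + ‖p.1‖ ^ 2) * (1 + ‖p.2.2 - p.2.1‖ ^ 2))

/-- The zonal test is continuous. [folklore] -/
theorem continuous_zonalTest : Continuous zonalTest := by
  unfold zonalTest
  have hb : Continuous fun p : V3 × V3 × V3 => p.2.2 - p.2.1 := continuous_snd.snd.sub continuous_snd.fst
  refine ((continuous_fst.inner hb).pow 2).div ((continuous_const.add (continuous_fst.norm.pow 2)).mul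
    (continuous_const.add (hb.norm.pow 2))) fun p => ?_
  positivity

/-- The zonal test is bounded by `1`. [folklore] -/
theorem abs_zonalTest_le_one (p : V3 × V3 × V3) : |zonalTest p| ≤ 1 := by
  unfold zonalTest
  set b := p.2.2 - p.2.1
  have hden : 0 < (1 + ‖p.1‖ ^ 2) * (1 + ‖b‖ ^ 2) := by positivity
  rw [abs_div, abs_of_pos hden, div_le_one hden, abs_of_nonneg (sq_nonneg _)]
  have h1 : |⟪p.1, b⟫_ℝ| ≤ ‖p.1‖ * ‖b‖ := abs_real_inner_le_norm _ _
  have h2 : ⟪p.1, b⟫_ℝ ^ 2 ≤ (‖p.1‖ * ‖b‖) ^ 2 := by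
    rw [← sq_abs]
    exact pow_le_pow_left₀ (abs_nonneg _) h1 2
  nlinarith [norm_nonneg p.1, norm_nonneg b, mul_nonneg (sq_nonneg ‖p.1‖) (sq_nonneg ‖b‖)]

/-! ## §3 `H` (F2) and the negative lemma `H → ¬ KickFairRelEquilibrium` (sorry-free) -/

/-- **`H`: the sub-cell clustering bias persists.** See the module docstring, F2: under `LG` with the
tilted activity (`θ₀ ≡ 1`, `u₀ ≡ 0`) and the zonal kick test, for every `σ₀` there are `σ < σ₀`, a
flow family, `τ`, a FIXED `r` and `δ > 0` such that for infinitely many `N` SOME admissible weight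
(measurable on the typed past, `|h| ≤ 1`; by the cartoon kit j017199 already `h ≡ 1`, else the sign of the
first-order tube-overlap functional) gives `E_{LG}|S_h| > δ` (predicted limit
`⟨r²|∇log a₀|²/6⟩ · |E_Palm B_U| · εΓτ`, `E_Palm B_U(zonalTest) = −0.00174(3)` at `φ = 0.05`). Not
constructible in the tree (F1). Identical to the `H` of the Negative file.
[topic MathematicalPhysics/KineticTheory] -/
def SubcellClusteringBiasPersists : Prop :=
  ∀ σ₀ : ℝ, 0 < σ₀ → ∃ σ : ℝ, 0 < σ ∧ σ < σ₀ ∧ ∃ Φ : (N : ℕ) → Flow σ N, ∃ τ : ℝ, 0 < τ ∧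
    ∃ r : ℝ, 0 < r ∧ ∃ δ : ℝ, 0 < δ ∧ ∀ N₀ : ℕ, ∃ N : ℕ, N₀ ≤ N ∧
      ∃ h : Fin (N + 1) → ℕ → PastRel N → ℝ, (∀ i n, Measurable (h i n)) ∧
        (∀ i n p, |h i n p| ≤ 1) ∧
        ¬ KickBoundRel σ tiltedActivity (fun _ => 1) (fun _ => 0) N (Φ N) τ r zonalTest h δ

/-- **NEGATIVE LEMMA MODULO `H`: `SubcellClusteringBiasPersists → ¬ KickFairRelEquilibrium`.** -/
theorem kickFairRelEquilibrium_false_of_subcellClusteringBiasPersists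
    (H : SubcellClusteringBiasPersists) : ¬ KickFairRelEquilibrium := by
  intro hK
  obtain ⟨σ₀, hσ₀, hall⟩ := (kickFairRelEquilibrium_iff.1 hK) tiltedActivity (fun _ => 1)
    (fun _ => 0) continuous_tiltedActivity continuous_const continuous_const tiltedActivity_pos
    (fun _ => one_pos)
  obtain ⟨σ, hσ, hσσ₀, Φ, τ, hτ, r, hr, δ, hδ, hN⟩ := H σ₀ hσ₀
  obtain ⟨N₀, hN₀⟩ := hall σ hσ hσσ₀ Φ τ hτ r hr zonalTest continuous_zonalTest
    ⟨1, abs_zonalTest_le_one⟩ δ hδ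
  obtain ⟨N, hle, h, hhm, hhb, hnot⟩ := hN N₀
  exact hnot (hN₀ N hle h hhm hhb)

/-! ## §4 Line `Sketch` — Targets: the registered stub `stub_eqKickTail` is false modulo `H'` (F3) -/

/-- **Verbatim restatement of `Cruxes/KickFairRelEquilibrium/Lines/Sketch.lean :: Holds.stub_eqKickTail`**
(its type, copied textually; that module is not importable on the farm). -/
def StubEqKickTail : Prop :=
    ∀ θ₁ : ℝ, 0 < θ₁ → ∃ σ₁ : ℝ, 0 < σ₁ ∧ ∀ σ : ℝ, 0 < σ → σ < σ₁ →
    ∀ Φ : (N : ℕ) → HardSphereFlow (Literature.Analysis.FluidPDE.Torus.geometry (Fin 3))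
      (hsDiameter σ N) (N + 1),
    ∀ τ : ℝ, 0 < τ → ∀ r : ℝ, 0 < r →
    ∀ g : V3 × V3 × V3 → ℝ, Continuous g → (∃ C : ℝ, ∀ p, |g p| ≤ C) →
    ∀ δ : ℝ, 0 < δ → ∀ K : ℝ, ∃ N₀ : ℕ, ∀ N : ℕ, N₀ ≤ N →
    ∀ h : Fin (N + 1) → ℕ →
      (((Fin (N + 1) → (Fin 3 → ℤ) × V3) × (Fin (N + 1) → (Fin 3 → ℤ) × V3)) × Fin (N + 1)) ×
        (ℝ × ℝ × ℝ) → ℝ,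
    (∀ i n, Measurable (h i n)) → (∀ i n p, |h i n p| ≤ 1) →
    let ε := hsDiameter σ N
    let G : Geometry (Fin 3) T3 := Literature.Analysis.FluidPDE.Torus.geometry (Fin 3)
    let q : T3 → (Fin 3 → ℤ) := Literature.Analysis.FluidPDE.Torus.coarseCell r
    let γ : Config (N + 1) (Fin 3) T3 → ℝ → Config (N + 1) (Fin 3) T3 := fun z s => (Φ N).flow s z
    let cnt : Config (N + 1) (Fin 3) T3 → Fin (N + 1) → ℕ := fun z i =>
      Set.ncard (collisionTimesOf G ε (γ z) i ∩ Set.Ioc 0 τ)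
    let P : Config (N + 1) (Fin 3) T3 → Fin (N + 1) → ℕ →
        (((Fin (N + 1) → (Fin 3 → ℤ) × V3) × (Fin (N + 1) → (Fin 3 → ℤ) × V3)) × Fin (N + 1)) ×
          (ℝ × ℝ × ℝ) := fun z i n =>
      if z ∈ (Φ N).good then
        (((Φ N).coarsePastOf q i n z, (Φ N).nthPartnerOf i n z),
          (flightStart G ε (γ z) 0 i ((Φ N).nthCollisionTimeOf i n z),
            flightStart G ε (γ z) 0 ((Φ N).nthPartnerOf i n z) ((Φ N).nthCollisionTimeOf i n z),
            (Φ N).nthCollisionTimeOf i n z))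
      else (((fun _ => (0, 0), fun _ => (0, 0)), 0), (0, 0, 0))
    let X : Fin (N + 1) → ℕ → Config (N + 1) (Fin 3) T3 → V3 × V3 × V3 := fun i n z =>
      if z ∈ (Φ N).good then (((Φ N).nthRecordOf i n z).impactVec, ((Φ N).nthRecordOf i n z).preVel)
      else 0
    let κ : Fin (N + 1) → ℕ → Config (N + 1) (Fin 3) T3 → ℝ := fun i n =>
      MeasureTheory.condExp (MeasurableSpace.comap (fun z => P z i n) inferInstance)
        (localGibbsLaw σ (fun _ => 1) (fun _ => 0) (fun _ => 1) N (Φ N)) (fun z => g (X i n z))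
    let S : Config (N + 1) (Fin 3) T3 → ℝ := fun z =>
      ε / (N + 1 : ℝ) * ∑ i : Fin (N + 1), ∑ n ∈ Finset.range (cnt z i),
        h i n (P z i n) * (g (X i n z) - κ i n z)
    ∫⁻ z, ENNReal.ofReal (|S z| - δ)
        ∂(localGibbsLaw σ (fun _ => 1) (fun _ => 0) (fun _ => θ₁) N (Φ N)) ≤
      ENNReal.ofReal (Real.exp (-(K * ((N : ℝ) + 1))))

/-- The stub's conclusion for given data: the `δ`-excess of the centred kick sum has
`L¹(G_{θ₁})`-size at most `e^{−K(N+1)}`. -/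
def TailBoundRel (σ θ₁ : ℝ) (N : ℕ) (Φ : Flow σ N) (τ r : ℝ) (g : V3 × V3 × V3 → ℝ)
    (h : Fin (N + 1) → ℕ → PastRel N → ℝ) (δ K : ℝ) : Prop :=
  ∫⁻ z, ENNReal.ofReal (|kickSumRel σ N Φ τ r g h z| - δ)
      ∂(localGibbsLaw σ (fun _ => 1) (fun _ => 0) (fun _ => θ₁) N Φ) ≤
    ENNReal.ofReal (Real.exp (-(K * ((N : ℝ) + 1))))

/-- **Faithful restatement of the stub** through `kickSumRel` / `TailBoundRel` (definitional). -/
theorem stubEqKickTail_iff :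
    StubEqKickTail ↔
      ∀ θ₁ : ℝ, 0 < θ₁ → ∃ σ₁ : ℝ, 0 < σ₁ ∧ ∀ σ : ℝ, 0 < σ → σ < σ₁ →
        ∀ Φ : (N : ℕ) → Flow σ N, ∀ τ : ℝ, 0 < τ → ∀ r : ℝ, 0 < r →
        ∀ g : V3 × V3 × V3 → ℝ, Continuous g → (∃ C : ℝ, ∀ p, |g p| ≤ C) →
        ∀ δ : ℝ, 0 < δ → ∀ K : ℝ, ∃ N₀ : ℕ, ∀ N : ℕ, N₀ ≤ N →
        ∀ h : Fin (N + 1) → ℕ → PastRel N → ℝ, (∀ i n, Measurable (h i n)) →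
        (∀ i n p, |h i n p| ≤ 1) → TailBoundRel σ θ₁ N (Φ N) τ r g h δ K :=
  Iff.rfl

/-- **Kernel check of the restatement.** `StubEqKickTail` IS, definitionally, the hypothesis of the
LANDED Stage-1 reduction `Theorems.KickFairRelEquilibrium_of_eqKickTail` (= the registered stub
`Sketch.Holds.stub_eqKickTail`): this `example` elaborates only because the two `let`-chains agree. -/
example : StubEqKickTail → KickFairRelEquilibrium :=
  Summit.AtomisticToContinuum.HydrodynamicLimit.Theorems.KickFairRelEquilibrium_of_eqKickTail

/-- **`H'`: a speed-`N` lower bound for the tail of the centred kick sum under the invariant law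
(sub-cell hydrodynamic modes).** See the module docstring, F3: at some temperature `θ₁`, for every
`σ₁` there are `σ < σ₁`, a flow family, `τ`, a FIXED `r`, `δ > 0` and a rate `K` such that for
infinitely many `N` SOME admissible weight gives `∫⁻ (|S_h| − δ)₊ dG_{θ₁} > e^{−K(N+1)}` for the zonal
kick test (mechanism: sub-cell density modes of amplitude `a² ≍ δ` cost `e^{−cNa²}`, are invisible to
the typed past, persist over `[0, τ]`, and move the centred zonal kicks by `a² · B_U(P)`). Not
constructible in the tree (F1 + persistence of hydrodynamic modes of the deterministic flow).
[topic MathematicalPhysics/KineticTheory] -/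
def SubcellModeTailLowerBound : Prop :=
  ∃ θ₁ : ℝ, 0 < θ₁ ∧ ∀ σ₁ : ℝ, 0 < σ₁ → ∃ σ : ℝ, 0 < σ ∧ σ < σ₁ ∧ ∃ Φ : (N : ℕ) → Flow σ N,
    ∃ τ : ℝ, 0 < τ ∧ ∃ r : ℝ, 0 < r ∧ ∃ δ : ℝ, 0 < δ ∧ ∃ K : ℝ, ∀ N₀ : ℕ, ∃ N : ℕ, N₀ ≤ N ∧
      ∃ h : Fin (N + 1) → ℕ → PastRel N → ℝ, (∀ i n, Measurable (h i n)) ∧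
        (∀ i n p, |h i n p| ≤ 1) ∧ ¬ TailBoundRel σ θ₁ N (Φ N) τ r zonalTest h δ K

/-- **STUB KILL MODULO `H'`: `SubcellModeTailLowerBound → ¬ StubEqKickTail`** (the zonal test is
admissible and the weight's admissibility is part of `H'`, so the stub's bound would apply at the rate
`K` of `H'`). -/
theorem stubEqKickTail_false_of_subcellModeTailLowerBound (H : SubcellModeTailLowerBound) :
    ¬ StubEqKickTail := by
  intro hS
  obtain ⟨θ₁, hθ₁, hH⟩ := H
  obtain ⟨σ₁, hσ₁, hall⟩ := (stubEqKickTail_iff.1 hS) θ₁ hθ₁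
  obtain ⟨σ, hσ, hσσ₁, Φ, τ, hτ, r, hr, δ, hδ, K, hN⟩ := hH σ₁ hσ₁
  obtain ⟨N₀, hN₀⟩ := hall σ hσ hσσ₁ Φ τ hτ r hr zonalTest continuous_zonalTest
    ⟨1, abs_zonalTest_le_one⟩ δ hδ K
  obtain ⟨N, hle, h, hhm, hhb, hnot⟩ := hN N₀
  exact hnot (hN₀ N hle h hhm hhb)

/-! ## §5 Typing lemma: the collision enumeration recycles past the last collision (F0) -/

/-- With a single collision time `t₀ > 0`, `nextTimeAfter {t₀} 0 = t₀`. [folklore] -/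
theorem nextTimeAfter_singleton_zero {t₀ : ℝ} (ht : 0 < t₀) : nextTimeAfter {t₀} 0 = t₀ := by
  unfold nextTimeAfter
  rw [show ({t₀} : Set ℝ) ∩ Ioi 0 = {t₀} from
    inter_eq_left.2 (singleton_subset_iff.2 (mem_Ioi.2 ht)), csInf_singleton]

/-- … and past it the enumerator returns the junk `sInf ∅ = 0`. [folklore] -/
theorem nextTimeAfter_singleton_self (t₀ : ℝ) : nextTimeAfter {t₀} t₀ = 0 := by
  unfold nextTimeAfter
  rw [show ({t₀} : Set ℝ) ∩ Ioi t₀ = ∅ from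
    eq_empty_of_forall_notMem fun s hs => (lt_irrefl t₀) (by
      rcases hs with ⟨hs1, hs2⟩
      rw [mem_singleton_iff] at hs1
      rw [hs1] at hs2
      exact hs2), Real.sInf_empty]

/-- **Recycling.** For a particle with exactly one collision, at `t₀ > 0`, the `n`-th collision time
RESTARTS with period `2`: even indices return the genuine collision `t₀`, odd ones the junk `0`. So
`nthCollisionTimeOf i 2 = nthCollisionTimeOf i 0` although only `n = 0 < cnt = 1` enters the sum:
the cut `n < cnt` is not a function of the enumerated time (nor, in general, of the typed past). -/
theorem nthTimeAfter_singleton {t₀ : ℝ} (ht : 0 < t₀) (m : ℕ) :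
    nthTimeAfter {t₀} 0 (2 * m) = t₀ ∧ nthTimeAfter {t₀} 0 (2 * m + 1) = 0 := by
  induction m with
  | zero =>
    refine ⟨by rw [Nat.mul_zero, Literature.Analysis.FluidPDE.nthTimeAfter_zero,
      nextTimeAfter_singleton_zero ht], ?_⟩
    rw [Nat.mul_zero, Nat.zero_add, Literature.Analysis.FluidPDE.nthTimeAfter_succ,
      Literature.Analysis.FluidPDE.nthTimeAfter_zero, nextTimeAfter_singleton_zero ht,
      nextTimeAfter_singleton_self]
  | succ m ih =>
    have h1 : nthTimeAfter {t₀} 0 (2 * (m + 1)) = t₀ := by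
      rw [show 2 * (m + 1) = (2 * m + 1) + 1 by ring, Literature.Analysis.FluidPDE.nthTimeAfter_succ,
        ih.2, nextTimeAfter_singleton_zero ht]
    refine ⟨h1, ?_⟩
    rw [Literature.Analysis.FluidPDE.nthTimeAfter_succ, h1, nextTimeAfter_singleton_self]

/-! ## §6 Outlook (for the re-arm): the repaired decl under R1 / R2

* **R1** (`∀ δ ∃ r₀ ∀ r < r₀ ∃ N₀`): `H` no longer bites (`c₂ ∝ r² < δ`-scale), but `H'` still does
  (sub-cell modes with `N^{-1/6} ≪ λ ≪ r` exist at every fixed `r`): the decl becomes plausible, the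
  line's super-exponential stub stays dead — (b) would have no `G`-referenced line.
* **R2** (cells `r_N`, `ε ≪ r_N ≪ N^{-1/6}`, e.g. `Torus.coarseCell ((N+1)^{-1/4})`): neither `H` nor `H'`
  bites — `c₂ ∝ r_N² → 0`; structures invisible to the past live `r_N²/(ℓv̄) ≪ τ`; the kernel stays
  diffuse (`ε/r_N = σ N^{-1/12} → 0`, slowly: a factor `3` at `N = 10⁶`); flights stay inside a cell
  (`r_N/ℓ = N^{1/12} → ∞`, equally slowly); the affine pinning count is unchanged (`≈ N/2` resolved
  kicks `< 1.5 N`). This seat has NO mechanism against the R2 decl or the R2 stub; the next attacks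
  would be (i) the two SLOW separations above at any accessible `N` (an MD test of the R2 statistic is
  meaningless below `N ≈ 10⁹`), (ii) the summation-cut measurability obligation (F0) and the
  Borel-measurability of the `r_N`-cell past, (iii) whether `N`-dependent cells let `h` encode `N`-scale
  information that pins more (no: cells only coarsen positions).
-/

end

end Summit.AtomisticToContinuum.HydrodynamicLimit.Cruxes.KickFairRelEquilibrium.Disproof
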